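import Summits.QuantumFields.YangMills.Theorems.UV3BranchExpansionCountingAmortizedLetters
import HarnessLib

/-!
# `UV3BranchExpansionCountingAmortizedStep` — ONE LEVEL of the AMORTIZED COVERING INEQUALITY for the branch (Möbius) expansion of the
# guarded averaging (crux `UnitScaleTilt.HistoryTailL`, stmt-QuantumFields-19936 — SUPPLY side, record-independent finite combinatorics)

Cell `ym3-torus` (YM ladder rung R3 = continuum SU(2) Yang–Mills on T³ — a RUNG, NOT d = 4, NOT infinite volume, NOT a mass gap, NOT Clay);
width seat `ym-ust-19936-w2` (gen 17), explicit-unit helper; `--supports stmt-QuantumFields-19936 --as helper`.  THEOREMS ONLY (0 `def`,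
0 `sorry`, default heartbeats, Mathlib + HarnessLib imports only).

WHAT.  LEAD ★w1-19936 g12's design note `Cruxes/HistoryTailL/HTopBranchExpansion.md` §5 (C) bounds the sum `Σ_{𝐬 live} x^{|𝐬|}` over the live
switch-site patterns of the branch expansion by exploration trees.  The injection «live pattern ↦ first-discovery tree with disjoint slot
fillings and no empty ghost side slot» asserted there does not exist (a side slot of a ghost segment may be covered by a reader that is
discovered elsewhere — SHARED READERS; bus 2026-08-30 w2 g17 FINDING).  The present file is the one-level step of the REPAIR: a covering
inequality proved by induction on levels directly on PATTERN SUMS (no trees, no injection), in which a reader-covered side slot that receives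
no new reader is charged a penalty factor `y ∈ (0,1)`; the penalty is compensated globally by the reader CAPACITY (each reader's read set
contains side slots of at most `s₀` foreign segments), which is why the activity enters as `x' = x·y^{-s₀}` (that conversion is NOT in this
file — it is one line of the multi-level assembly).

ABSTRACT ONE-LEVEL SETTING.  Two finite bond types: `β` (the upper level) and `γ` (the level below); for every upper bond `g : β` a read set
`R g : Finset γ`, a straight segment `line g : Finset γ` of exactly `L` bonds, pairwise disjoint, with a distinguished crossing bond
`ctr g ∈ line g` that is PRIVATE (`ctr g ∈ R c → c = g`); `|R c| ≤ r₀`; every lower bond is read by at most `ρ₀` upper bonds.  The «lower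
world» is an arbitrary finite type `Λ` of lower configurations with nonnegative weights `w X λ` (allowed to depend on the explored set
`X` the lower exploration is started from), a distorted-set map `Δ : Λ → Finset γ` and a lower discoverability predicate `disc X λ` («λ is
discoverable from the explored set `X`»), about which ONE thing is assumed — the induction hypothesis
`hW : Σ_{λ : X ⊆ Δ λ ∧ disc X λ} w X λ ≤ D^{|X|}` for every `X`.  An upper configuration is a pair `(λ, s)` (`s ⊆ β` the bonds fired
at this step); its distorted set is `DistUp λ s = s ∪ {g | line g ⊆ Δ λ ∪ R(s)}` (fired ∪ GHOSTS), the set explored below from a start set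
`A ⊆ β` is `Xp λ s A = (line(A ∖ s) ∪ R(s)) ∩ Δ λ`, and `(λ, s)` is discoverable from `A` iff `A ⊆ DistUp λ s`, every fired bond is explored
or reads a side slot of an explored ghost (`s ⊆ A ∪ N(A ∖ s)`), and `λ` is discoverable from `Xp λ s A`.  The three set-valued maps are
HYPOTHESIS-SPECIFIED (`hDistUp`, `hXp`, `hN`) so that the multi-level assembly instantiates them with its own recursively specified families.

MAIN THEOREM ★★★ `sum_step_le_pow` (§3): for every `A ⊆ β`,
`Σ_{(λ,s) disc. from A} w (Xp λ s A) λ · x'^{|s ∩ A|} · (x'/y)^{|s ∖ A|} · y^{|Side(A∖s) ∖ Δ λ|} ≤ (E + D·(y + D)^{L−1}·(1 + E/y)^{(L−1)ρ₀})^{|A|}`,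
`E := x'(1 + D)^{r₀}`, `Side(G) := ⋃_{g∈G} line g ∖ {ctr g}` — i.e. the induction hypothesis one level up with
**`D' = E + D·(y + D)^{L−1}·(1 + E/y)^{(L−1)ρ₀}`**.  The exponent of `y` is `(# side slots of explored ghosts that are not distorted) −
(# new readers)`, split into the two natural-number exponents `|Side(A∖s) ∖ Δ λ|` and `|s ∖ A|`.

PROOF.  For fixed `s` put `G := A ∖ s` (the explored ghosts) and `U := line(G) ∪ R(s)`.  Privacy and `g ∉ s` force `ctr(G) ⊆ Δ λ`, hence the
explored set `X' := U ∩ Δ λ` contains `ctr(G)`; summing the lower weights along the fibres of `λ ↦ X'` and using `hW` (§3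
`sum_lower_le_sum_explored`) leaves `Σ_{ctr(G) ⊆ X' ⊆ U} y^{|Side G ∖ X'|}·D^{|X'|}`, which §2 `sum_explored_le` evaluates through the injection
`X' ↦ (X' ∩ Side G, X' ∖ line G)` and two binomial identities as `≤ D^{|G|}·(y + D)^{(L−1)|G|}·(1 + D)^{|R(s)|}`.  The outer sum over `s` is
re-indexed by `s ↦ (s ∩ A, s ∖ A) ∈ Σ_{F ⊆ A} 𝒫(N(A ∖ F))` (§3 `sum_upper_le`), the new-reader sum is `(1 + E/y)^{|N(A∖F)|} ≤
(1 + E/y)^{(L−1)ρ₀|A∖F|}` (§1 `card_N_le`), and `Σ_{F ⊆ A} E^{|F|}Γ^{|A|−|F|} = (E + Γ)^{|A|}` is `Finset.sum_pow_mul_eq_add_pow`.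

HONEST SCOPE.  Finite combinatorics of one displayed recursion step; the model-specific letters (`PBond`, the read sets of the (0.4) guard,
`r₀`, `ρ₀`, `s₀`, `K_α`, `p_adm`), the multi-level induction, the capacity conversion `x^{|𝐬|} ≤ x'^{|𝐬|}y^{f(𝐬)}` and the lemma «live ⇒
discoverable» are NOT here.  Nothing of hTop, the χ (α) record `AlphaInputsT3ACv4RecChi`, (O‴χₛ), `HistoryTailL`, the rung R3 is proved;
the Yang–Mills mass gap is NOT proved.

References: T. Bałaban, CMP **102** (1985) 255–275 [Balaban1985UV3] ((47), (55) pp.268–270: the averaged densities whose top push-forward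
hTop serves); LEAD note `Cruxes/HistoryTailL/HTopBranchExpansion.md` §5–§6 (2026-08-30); dag-n08-d `N08-HJ-M3-SPEC-g47.md` §1 (read sets).
-/

set_option autoImplicit false

namespace Summit.QuantumFields.YangMills.Theorems.UV3BranchExpansionCountingAmortizedStep

open Finset Summit.QuantumFields.YangMills.Theorems.UV3BranchExpansionCountingAmortizedLetters

variable {β γ : Type*}

/-! ## §3 The one-level transfer `W_{i+1}(A) ≤ D'^{|A|}` -/

section Step

variable [Fintype β] [DecidableEq β] [DecidableEq γ]
variable {Λ : Type*} [Fintype Λ]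
variable (R line : β → Finset γ) (ctr : β → γ) {L r₀ ρ₀ : ℕ}
variable (w : Finset γ → Λ → ℝ) (Δ : Λ → Finset γ) (disc : Finset γ → Λ → Prop) [∀ X l, Decidable (disc X l)]
variable (DistUp : Λ → Finset β → Finset β) (Xp : Λ → Finset β → Finset β → Finset γ) (N : Finset β → Finset β)

omit [Fintype β] in
/-- ★★ **SUMMING THE LOWER WORLD ALONG THE FIBRES OF THE EXPLORED SET.**  For a fixed fired set `s` and start set `A` (ghosts `G := A ∖ s`,
universe `U := line(G) ∪ R(s)`): privacy forces every crossing bond of `G` into the lower distorted set, so the explored set `X' = U ∩ Δ λ`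
contains `ctr(G)`; grouping the lower configurations by `X'` and bounding each fibre by the full lower sum indexed by `X'` gives
`Σ_{λ : A ⊆ DistUp λ s ∧ disc (Xp λ s A) λ} w (Xp λ s A) λ·y^{|Side G ∖ Δ λ|} ≤ Σ_{ctr(G) ⊆ X' ⊆ U} y^{|Side G ∖ X'|}·W(X')`,
`W(X') := Σ_{λ : X' ⊆ Δ λ ∧ disc X' λ} w X' λ` (the lower weight may depend on the explored set it is started from). [folklore] -/
theorem sum_lower_le_sum_explored (hw : ∀ X l, 0 ≤ w X l) (hctr : ∀ g, ctr g ∈ line g)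
    (hpriv : ∀ g c, ctr g ∈ R c → c = g)
    (hDistUp : ∀ l s g, g ∈ DistUp l s ↔ g ∈ s ∨ line g ⊆ Δ l ∪ s.biUnion R)
    (hXp : ∀ l s A, Xp l s A = ((A \ s).biUnion line ∪ s.biUnion R) ∩ Δ l)
    {y : ℝ} (hy : 0 ≤ y) (s A : Finset β) :
    ∑ l ∈ Finset.univ.filter (fun l => A ⊆ DistUp l s ∧ disc (Xp l s A) l),
        w (Xp l s A) l * y ^ (((A \ s).biUnion (fun g => (line g).erase (ctr g))) \ Δ l).card
      ≤ ∑ X' ∈ (((A \ s).biUnion line ∪ s.biUnion R).powerset).filter (fun X' => (A \ s).image ctr ⊆ X'),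
          y ^ (((A \ s).biUnion (fun g => (line g).erase (ctr g))) \ X').card *
            ∑ l ∈ Finset.univ.filter (fun l => X' ⊆ Δ l ∧ disc X' l), w X' l := by
  classical
  set G := A \ s with hG
  set U := G.biUnion line ∪ s.biUnion R with hU
  set SideG := G.biUnion (fun g => (line g).erase (ctr g)) with hSideG
  set I := U.powerset.filter (fun X' => G.image ctr ⊆ X') with hI
  set S₀ := Finset.univ.filter (fun l => A ⊆ DistUp l s ∧ disc (Xp l s A) l) with hS₀
  have hSideU : SideG ⊆ U := by
    intro b hb
    obtain ⟨g, hg, hb'⟩ := Finset.mem_biUnion.mp hb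
    exact Finset.mem_union_left _ (Finset.mem_biUnion.mpr ⟨g, hg, Finset.mem_of_mem_erase hb'⟩)
  -- the explored set of a lower configuration in `S₀` lies in `I`
  have hmaps : ∀ l ∈ S₀, U ∩ Δ l ∈ I := by
    intro l hl
    have hA : A ⊆ DistUp l s := (Finset.mem_filter.mp hl).2.1
    refine Finset.mem_filter.mpr ⟨Finset.mem_powerset.mpr Finset.inter_subset_left, ?_⟩
    intro b hb
    obtain ⟨g, hg, rfl⟩ := Finset.mem_image.mp hb
    have hgA : g ∈ A := (Finset.mem_sdiff.mp hg).1
    have hgs : g ∉ s := (Finset.mem_sdiff.mp hg).2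
    have hline : line g ⊆ Δ l ∪ s.biUnion R := by
      rcases (hDistUp l s g).mp (hA hgA) with h | h
      · exact absurd h hgs
      · exact h
    have hctrΔ : ctr g ∈ Δ l := by
      rcases Finset.mem_union.mp (hline (hctr g)) with h | h
      · exact h
      · exact absurd h (ctr_not_mem_biUnion_R R ctr hpriv hgs)
    exact Finset.mem_inter.mpr ⟨Finset.mem_union_left _ (Finset.mem_biUnion.mpr ⟨g, hg, hctr g⟩), hctrΔ⟩
  rw [← Finset.sum_fiberwise_of_maps_to hmaps]
  refine Finset.sum_le_sum (fun X' hX' => ?_)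
  -- on the fibre over `X'`: `Side G ∖ Δ λ = Side G ∖ X'`
  have hfib : ∀ l ∈ S₀.filter (fun l => U ∩ Δ l = X'),
      w (Xp l s A) l * y ^ (SideG \ Δ l).card = y ^ (SideG \ X').card * w X' l := by
    intro l hl
    have hX : U ∩ Δ l = X' := (Finset.mem_filter.mp hl).2
    have hXp' : Xp l s A = X' := by rw [hXp, ← hX]
    have : SideG \ Δ l = SideG \ X' := by
      rw [← hX]; ext b; simp only [Finset.mem_sdiff, Finset.mem_inter, not_and]
      constructor
      · rintro ⟨hb, hb'⟩; exact ⟨hb, fun _ => hb'⟩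
      · rintro ⟨hb, hb'⟩; exact ⟨hb, hb' (hSideU hb)⟩
    rw [this, hXp', mul_comm]
  rw [Finset.sum_congr rfl hfib, ← Finset.mul_sum]
  refine mul_le_mul_of_nonneg_left ?_ (by positivity)
  -- the fibre is contained in the index set of `W(X')`
  refine Finset.sum_le_sum_of_subset_of_nonneg ?_ (fun l _ _ => hw X' l)
  intro l hl
  have hl' := Finset.mem_filter.mp hl
  have hX : U ∩ Δ l = X' := hl'.2
  have hXp' : Xp l s A = X' := by rw [hXp, ← hX]
  refine Finset.mem_filter.mpr ⟨Finset.mem_univ _, ?_, ?_⟩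
  · rw [← hX]; exact Finset.inter_subset_right
  · rw [← hXp']; exact (Finset.mem_filter.mp hl'.1).2.2

/-- ★★★ **THE ONE-LEVEL TRANSFER OF THE AMORTIZED COVERING INEQUALITY.**  If the lower world satisfies the induction hypothesis
`Σ_{λ : X ⊆ Δ λ ∧ disc X λ} w X λ ≤ D^{|X|}` for every explored set `X`, then for every start set `A` of upper bonds
`Σ_{(λ,s) discoverable from A} w (Xp λ s A) λ · x'^{|s ∩ A|} · (x'/y)^{|s ∖ A|} · y^{|Side(A ∖ s) ∖ Δ λ|} ≤ (E + D·(y + D)^{L−1}·(1 + E/y)^{(L−1)ρ₀})^{|A|}`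
with `E = x'(1 + D)^{r₀}` — the same hypothesis one level up with `D' = E + D(y + D)^{L−1}(1 + E/y)^{(L−1)ρ₀}`.
(`y ∈ (0,1]` is the penalty of a reader-covered side slot that receives no new reader; `x' = x·y^{−s₀}` the capacity-corrected activity;
fired bonds of `A` cost `E`, ghosts of `A` cost `D` for their distorted crossing bond times `(y + D)` per side slot times `(1 + E/y)^{ρ₀}`
per side slot for the new readers they may recruit.) [folklore] -/
theorem sum_step_le_pow (hw : ∀ X l, 0 ≤ w X l) (hctr : ∀ g, ctr g ∈ line g) (hline : ∀ g, (line g).card = L)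
    (hdisj : ∀ g g', g ≠ g' → Disjoint (line g) (line g')) (hpriv : ∀ g c, ctr g ∈ R c → c = g)
    (hR : ∀ c, (R c).card ≤ r₀) (hρ : ∀ b : γ, (Finset.univ.filter (fun c => b ∈ R c)).card ≤ ρ₀)
    (hDistUp : ∀ l s g, g ∈ DistUp l s ↔ g ∈ s ∨ line g ⊆ Δ l ∪ s.biUnion R)
    (hXp : ∀ l s A, Xp l s A = ((A \ s).biUnion line ∪ s.biUnion R) ∩ Δ l)
    (hN : ∀ G c, c ∈ N G ↔ ∃ g ∈ G, ∃ b ∈ (line g).erase (ctr g), b ∈ R c)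
    {x' y D : ℝ} (hx : 0 ≤ x') (hy : 0 < y) (hD : 0 ≤ D)
    (hW : ∀ X : Finset γ, ∑ l ∈ Finset.univ.filter (fun l => X ⊆ Δ l ∧ disc X l), w X l ≤ D ^ X.card)
    (A : Finset β) :
    ∑ s : Finset β, ∑ l : Λ,
        (if A ⊆ DistUp l s ∧ s ⊆ A ∪ N (A \ s) ∧ disc (Xp l s A) l then
          w (Xp l s A) l * x' ^ (s ∩ A).card * (x' / y) ^ (s \ A).card *
            y ^ (((A \ s).biUnion (fun g => (line g).erase (ctr g))) \ Δ l).card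
        else 0)
      ≤ (x' * (1 + D) ^ r₀ + D * (y + D) ^ (L - 1) * (1 + x' / y * (1 + D) ^ r₀) ^ ((L - 1) * ρ₀)) ^ A.card := by
  classical
  have hy0 : 0 ≤ y := hy.le
  set E := x' * (1 + D) ^ r₀ with hE
  set Γ := D * (y + D) ^ (L - 1) * (1 + x' / y * (1 + D) ^ r₀) ^ ((L - 1) * ρ₀) with hΓ
  have hE0 : 0 ≤ E := by positivity
  have hEy0 : 0 ≤ x' / y * (1 + D) ^ r₀ := by positivity
  -- §A: the inner (lower-world) sum for a fixed fired set `s`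
  have inner : ∀ s : Finset β,
      ∑ l : Λ, (if A ⊆ DistUp l s ∧ s ⊆ A ∪ N (A \ s) ∧ disc (Xp l s A) l then
          w (Xp l s A) l * x' ^ (s ∩ A).card * (x' / y) ^ (s \ A).card *
            y ^ (((A \ s).biUnion (fun g => (line g).erase (ctr g))) \ Δ l).card else 0)
        ≤ if s ⊆ A ∪ N (A \ s) then
            E ^ (s ∩ A).card * (x' / y * (1 + D) ^ r₀) ^ (s \ A).card *
              (D ^ (A \ s).card * (y + D) ^ ((L - 1) * (A \ s).card)) else 0 := by
    intro s
    by_cases hs : s ⊆ A ∪ N (A \ s)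
    · rw [if_pos hs]
      have hrw : ∀ l : Λ, (if A ⊆ DistUp l s ∧ s ⊆ A ∪ N (A \ s) ∧ disc (Xp l s A) l then
          w (Xp l s A) l * x' ^ (s ∩ A).card * (x' / y) ^ (s \ A).card *
            y ^ (((A \ s).biUnion (fun g => (line g).erase (ctr g))) \ Δ l).card else 0)
          = if A ⊆ DistUp l s ∧ disc (Xp l s A) l then
              x' ^ (s ∩ A).card * (x' / y) ^ (s \ A).card *
                (w (Xp l s A) l * y ^ (((A \ s).biUnion (fun g => (line g).erase (ctr g))) \ Δ l).card) else 0 := by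
        intro l
        by_cases h1 : A ⊆ DistUp l s ∧ disc (Xp l s A) l
        · rw [if_pos h1, if_pos ⟨h1.1, hs, h1.2⟩]; ring
        · rw [if_neg h1, if_neg (fun h => h1 ⟨h.1, h.2.2⟩)]
      rw [Finset.sum_congr rfl (fun l _ => hrw l), ← Finset.sum_filter, ← Finset.mul_sum]
      have hpre := sum_lower_le_sum_explored R line ctr w Δ disc DistUp Xp hw hctr hpriv hDistUp hXp hy0 s A
      have hexp := sum_explored_le line ctr hctr hline hdisj (A \ s) (s.biUnion R) hy0 hD
      -- bound `W(X') ≤ D^{|X'|}` inside the explored-set sum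
      have hmid : ∑ X' ∈ (((A \ s).biUnion line ∪ s.biUnion R).powerset).filter (fun X' => (A \ s).image ctr ⊆ X'),
            y ^ (((A \ s).biUnion (fun g => (line g).erase (ctr g))) \ X').card *
              ∑ l ∈ Finset.univ.filter (fun l => X' ⊆ Δ l ∧ disc X' l), w X' l
          ≤ ∑ X' ∈ (((A \ s).biUnion line ∪ s.biUnion R).powerset).filter (fun X' => (A \ s).image ctr ⊆ X'),
            y ^ (((A \ s).biUnion (fun g => (line g).erase (ctr g))) \ X').card * D ^ X'.card :=
        Finset.sum_le_sum (fun X' _ => mul_le_mul_of_nonneg_left (hW X') (by positivity))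
      have hRs : (1 + D) ^ (s.biUnion R).card ≤ ((1 + D) ^ r₀) ^ s.card := by
        rw [← pow_mul]
        exact pow_le_pow_right₀ (by linarith) (card_biUnion_R_le R hR s)
      have hsplit : x' ^ (s ∩ A).card * (x' / y) ^ (s \ A).card * ((1 + D) ^ r₀) ^ s.card
          = E ^ (s ∩ A).card * (x' / y * (1 + D) ^ r₀) ^ (s \ A).card := by
        rw [← Finset.card_inter_add_card_sdiff s A, pow_add, hE, mul_pow, mul_pow]; ring
      calc x' ^ (s ∩ A).card * (x' / y) ^ (s \ A).card *
            ∑ l ∈ Finset.univ.filter (fun l => A ⊆ DistUp l s ∧ disc (Xp l s A) l),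
              w (Xp l s A) l * y ^ (((A \ s).biUnion (fun g => (line g).erase (ctr g))) \ Δ l).card
          ≤ x' ^ (s ∩ A).card * (x' / y) ^ (s \ A).card *
              (D ^ (A \ s).card * (y + D) ^ ((L - 1) * (A \ s).card) * (1 + D) ^ (s.biUnion R).card) :=
            mul_le_mul_of_nonneg_left ((hpre.trans hmid).trans hexp) (by positivity)
        _ ≤ x' ^ (s ∩ A).card * (x' / y) ^ (s \ A).card *
              (D ^ (A \ s).card * (y + D) ^ ((L - 1) * (A \ s).card) * ((1 + D) ^ r₀) ^ s.card) := by
            gcongr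
        _ = E ^ (s ∩ A).card * (x' / y * (1 + D) ^ r₀) ^ (s \ A).card *
              (D ^ (A \ s).card * (y + D) ^ ((L - 1) * (A \ s).card)) := by
            rw [← hsplit]; ring
    · rw [if_neg hs]
      refine le_of_eq (Finset.sum_eq_zero (fun l _ => ?_))
      rw [if_neg (fun h => hs h.2.1)]
  -- §B: the outer sum over the fired set `s`, re-indexed by `s ↦ (s ∩ A, s ∖ A)`
  refine (Finset.sum_le_sum (fun s _ => inner s)).trans ?_
  rw [← Finset.sum_filter]
  set J := (Finset.univ : Finset (Finset β)).filter (fun s => s ⊆ A ∪ N (A \ s)) with hJ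
  let term : (Σ _ : Finset β, Finset β) → ℝ := fun p =>
    E ^ p.1.card * (x' / y * (1 + D) ^ r₀) ^ p.2.card * (D ^ (A \ p.1).card * (y + D) ^ ((L - 1) * (A \ p.1).card))
  let φ : Finset β → (Σ _ : Finset β, Finset β) := fun s => ⟨s ∩ A, s \ A⟩
  have hterm : ∀ s ∈ J, E ^ (s ∩ A).card * (x' / y * (1 + D) ^ r₀) ^ (s \ A).card *
      (D ^ (A \ s).card * (y + D) ^ ((L - 1) * (A \ s).card)) = term (φ s) := by
    intro s _
    have : A \ s = A \ (s ∩ A) := by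
      ext g; simp only [Finset.mem_sdiff, Finset.mem_inter, not_and']; tauto
    simp only [term, φ, this]
  have hinj : Set.InjOn φ J := by
    intro s₁ _ s₂ _ heq
    simp only [φ, Sigma.mk.inj_iff, heq_eq_eq] at heq
    rw [← Finset.sdiff_union_inter s₁ A, ← Finset.sdiff_union_inter s₂ A, heq.1, heq.2]
  have himg : J.image φ ⊆ A.powerset.sigma (fun F => (N (A \ F)).powerset) := by
    intro p hp
    obtain ⟨s, hs, rfl⟩ := Finset.mem_image.mp hp
    have hs' : s ⊆ A ∪ N (A \ s) := (Finset.mem_filter.mp hs).2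
    refine Finset.mem_sigma.mpr ⟨Finset.mem_powerset.mpr Finset.inter_subset_right, Finset.mem_powerset.mpr ?_⟩
    intro c hc
    have hcA : c ∉ A := (Finset.mem_sdiff.mp hc).2
    have : A \ s = A \ (s ∩ A) := by
      ext g; simp only [Finset.mem_sdiff, Finset.mem_inter, not_and']; tauto
    rcases Finset.mem_union.mp (hs' (Finset.mem_sdiff.mp hc).1) with h | h
    · exact absurd h hcA
    · rw [← this]; exact h
  have hterm0 : ∀ p ∈ A.powerset.sigma (fun F => (N (A \ F)).powerset), 0 ≤ term p := fun p _ => by positivity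
  calc ∑ s ∈ J, E ^ (s ∩ A).card * (x' / y * (1 + D) ^ r₀) ^ (s \ A).card *
          (D ^ (A \ s).card * (y + D) ^ ((L - 1) * (A \ s).card))
      = ∑ s ∈ J, term (φ s) := Finset.sum_congr rfl hterm
    _ = ∑ p ∈ J.image φ, term p := (Finset.sum_image hinj).symm
    _ ≤ ∑ p ∈ A.powerset.sigma (fun F => (N (A \ F)).powerset), term p :=
        Finset.sum_le_sum_of_subset_of_nonneg himg (fun p hp _ => hterm0 p hp)
    _ = ∑ F ∈ A.powerset, E ^ F.card * (D ^ (A \ F).card * (y + D) ^ ((L - 1) * (A \ F).card)) *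
          ∑ S ∈ (N (A \ F)).powerset, (x' / y * (1 + D) ^ r₀) ^ S.card := by
        rw [Finset.sum_sigma]
        refine Finset.sum_congr rfl (fun F _ => ?_)
        rw [Finset.mul_sum]
        refine Finset.sum_congr rfl (fun S _ => ?_)
        simp only [term]; ring
    _ ≤ ∑ F ∈ A.powerset, E ^ F.card * Γ ^ (A.card - F.card) := by
        refine Finset.sum_le_sum (fun F hF => ?_)
        have hFA : F ⊆ A := Finset.mem_powerset.mp hF
        rw [sum_powerset_pow_card, ← Finset.card_sdiff_of_subset hFA]
        have hNle : (1 + x' / y * (1 + D) ^ r₀) ^ (N (A \ F)).card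
            ≤ ((1 + x' / y * (1 + D) ^ r₀) ^ ((L - 1) * ρ₀)) ^ (A \ F).card := by
          rw [← pow_mul]
          exact pow_le_pow_right₀ (by linarith) (card_N_le R line ctr hctr hline hρ N hN (A \ F))
        calc E ^ F.card * (D ^ (A \ F).card * (y + D) ^ ((L - 1) * (A \ F).card)) *
              (1 + x' / y * (1 + D) ^ r₀) ^ (N (A \ F)).card
            ≤ E ^ F.card * (D ^ (A \ F).card * (y + D) ^ ((L - 1) * (A \ F).card)) *
              ((1 + x' / y * (1 + D) ^ r₀) ^ ((L - 1) * ρ₀)) ^ (A \ F).card :=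
              mul_le_mul_of_nonneg_left hNle (by positivity)
          _ = E ^ F.card * Γ ^ (A \ F).card := by
              rw [hΓ, mul_pow, mul_pow, ← pow_mul, mul_comm (L - 1) (A \ F).card]; ring
    _ = (E + Γ) ^ A.card := Finset.sum_pow_mul_eq_add_pow E Γ A

end Step

end Summit.QuantumFields.YangMills.Theorems.UV3BranchExpansionCountingAmortizedStep
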